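import Summits.ResolutionOfSingularities.ResolutionOfSingularities.Theorems.HilbertSamuelEliminationSigmaMaxModificationsCorridor3CPFramePropagationChart
import Literature.AlgebraicGeometry.Resolution.AlterationsEnlargingZ
import HarnessLib

/-!
# [OURS · L1 W4.2] D18 G6 (b): the chart presentation over `x_n` read on the TRANSFORMED FRAME `R[(z)/z_{j₀}][X']/(h')` for a centre
# `V(X, z)` of ANY dimension — `z` part of an r.s.p. `(z, w)` of `R` (curve and surface centres of a CP frame ADAPTED to the centre)
# (cell res-hironaka, LADDER-RESOLUTION rung L; slot W4.2, crux chain w42 `SigmaMaxModificationsCorridor3` stmt-ResolutionOfSingularities-19249;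
# `--supports stmt-ResolutionOfSingularities-19249 --as helper`; hand res-D-brk-3 (gen 6), generalisation of G5 (ii-b) p542708 from the point centre
# `J = 𝔪_B` to `J = ((z) + (X))/(h)`)

PURE COMMUTATIVE ALGEBRA, 0 `def`s, every declaration PROVED; OURS bookkeeping; NOT a statement of Hironaka's manuscript [Hironaka2017] nor of
[CossartJannsenSaito2020]/[CossartPiltant2019]. AI-written, weaker than expert review.

* **`exists_adjoinRoot_chart_presentation_along`** — `R` regular local of dimension `d + l` with r.s.p. `(z, w)`, `h ∈ R[X]` monic of degree
  `m` with `coeff_i h ∈ (z)^{m−i}` (`δ_J(h) ≥ 1` for `J` = the `z`-indices: the frame is ADAPTED to the centre `V(X, z)` and `h` is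
  EQUIMULTIPLE along it), `B = R[X]/(h)` (local); `J = (z̄, x)·B` the centre read in the frame, `g ∈ J`, `𝔔'` a prime of `B[J/g]` over `𝔪_B`,
  `ψ' : O₀ → (B[J/g])_{𝔔'}` a presentation (G2's output at a point over `x_n`). THEN for some `j₀ : Fin d` (a `z_{j₀}`-chart contains the
  point, G3b), with `S = R[(z)/z_{j₀}]` and `h' ∈ S[X]` the monic transform (p526498 with `J = univ` for the family `z`), there are a prime
  `𝔔₃` of `S[X]/(h')` contracting to `𝔪_R` and a presentation `ψ₃ : O₀ → (S[X]/(h'))_{𝔔₃}`. `d = dim R` (`l = 0`) is G5 (ii-b); `d = 2`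
  curve centres; `d = 1` surface centres (`S = R`).

References: Stacks 0804/0805 [StacksProject]; CP 2019 Prop. 2.6, (2.7) [CossartPiltant2019]; CJS LNM 2270 Thm. 2.3 [CossartJannsenSaito2020].
-/

noncomputable section

set_option linter.dupNamespace false

open IsLocalRing IsLocalization Polynomial
open Literature.AlgebraicGeometry.Resolution
open Summit.ResolutionOfSingularities.ResolutionOfSingularities.Theorems.SigmaMaxModificationsCorridor3.Moving

universe u

namespace Summit.ResolutionOfSingularities.ResolutionOfSingularities.Theorems.SigmaMaxModificationsCorridor3.Helpers

set_option maxHeartbeats 1600000 in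
-- many subalgebra / localisation coercions (affine blowup algebras of a quotient of a polynomial ring); elaboration is slow (as in G5 (ii-b))
/-- [OURS · L1 W4.2] **The presentation at a point over `x_n`, read on the transformed frame `R[(z)/z_{j₀}][X']/(h')`, for an adapted centre
`V(X, z)` of any dimension.** See the module docstring. [cite: StacksProject, Tag 0804] [cite: CossartPiltant2019, Prop. 2.6 and (2.7) (arXiv v1 pp. 13–14)] -/
theorem exists_adjoinRoot_chart_presentation_along {R : Type u} [CommRing R] [IsRegularLocalRing R] {d l : ℕ}
    (hdim : ringKrullDim R = (d + l : ℕ)) (z : Fin d → R) (y : Fin l → R)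
    (hzy : Ideal.span (Set.range (Fin.append z y)) = maximalIdeal R) {h : R[X]} (hmo : h.Monic)
    (hcoJ : ∀ i < h.natDegree, h.coeff i ∈ Ideal.span (Set.range z) ^ (h.natDegree - i)) [IsLocalRing (R[X] ⧸ Ideal.span {h})]
    (J : Ideal (R[X] ⧸ Ideal.span {h}))
    (hJ : J = ((Ideal.span (Set.range z)).map (C : R →+* R[X]) ⊔ Ideal.span {X}).map (Ideal.Quotient.mk (Ideal.span {h})))
    {g : R[X] ⧸ Ideal.span {h}} (hg : g ∈ J) (𝔔' : Ideal (blowupAlgebra J g)) [𝔔'.IsPrime]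
    (h𝔔' : 𝔔'.comap (algebraMap (R[X] ⧸ Ideal.span {h}) (blowupAlgebra J g)) = maximalIdeal (R[X] ⧸ Ideal.span {h}))
    {O₀ : Type u} [CommRing O₀] [IsLocalRing O₀] (ψ' : O₀ →+* Localization.AtPrime 𝔔')
    (hflat : @RingHom.Flat O₀ (Localization.AtPrime 𝔔') _ _ ψ') (hloc : IsLocalHom ψ')
    (hmap : (maximalIdeal O₀).map ψ' = maximalIdeal (Localization.AtPrime 𝔔'))
    (hres : Function.Surjective ((residue (Localization.AtPrime 𝔔')).comp ψ')) :
    ∃ (j₀ : Fin d) (h' : (blowupAlgebra (Ideal.span (Set.range z)) (z j₀))[X]) (𝔔₃ : Ideal (AdjoinRoot h')) (_ : 𝔔₃.IsPrime)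
      (ψ₃ : O₀ →+* Localization.AtPrime 𝔔₃),
      h'.Monic ∧ h'.natDegree = h.natDegree ∧
      (∀ i ∈ Finset.Icc 1 h.natDegree, h'.coeff (h.natDegree - i) *
        algebraMap R (blowupAlgebra (Ideal.span (Set.range z)) (z j₀)) (z j₀) ^ i =
          algebraMap R (blowupAlgebra (Ideal.span (Set.range z)) (z j₀)) (h.coeff (h.natDegree - i))) ∧
      ((𝔔₃.comap (AdjoinRoot.mk h')).comap C).comap (algebraMap R (blowupAlgebra (Ideal.span (Set.range z)) (z j₀))) = maximalIdeal R ∧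
      @RingHom.Flat O₀ (Localization.AtPrime 𝔔₃) _ _ ψ₃ ∧ IsLocalHom ψ₃ ∧
      (maximalIdeal O₀).map ψ₃ = maximalIdeal (Localization.AtPrime 𝔔₃) ∧
      Function.Surjective ((residue (Localization.AtPrime 𝔔₃)).comp ψ₃) := by
  subst hJ
  -- `𝔪_B ∩ R = 𝔪_R`
  haveI : IsLocalRing (AdjoinRoot h) := ‹IsLocalRing (R[X] ⧸ Ideal.span {h})›
  have hcomapR : ((maximalIdeal (R[X] ⧸ Ideal.span {h})).comap (Ideal.Quotient.mk (Ideal.span {h}))).comap C = maximalIdeal R :=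
    comap_C_comap_mk_maximalIdeal (h := h) hmo
  -- the generators `w = x`, `v_j = z̄_j` of `J` and the monic relation
  set w : (R[X] ⧸ Ideal.span {h}) := Ideal.Quotient.mk (Ideal.span {h}) X with hw
  set v : Fin d → (R[X] ⧸ Ideal.span {h}) := fun j => Ideal.Quotient.mk (Ideal.span {h}) (C (z j)) with hv
  have hwJ : w ∈ (((Ideal.span (Set.range z)).map (C : R →+* R[X]) ⊔ Ideal.span {X}).map (Ideal.Quotient.mk (Ideal.span {h}))) := Ideal.mem_map_of_mem _ (Ideal.mem_sup_right (Ideal.subset_span rfl))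
  have hvJ : ∀ j, v j ∈ (((Ideal.span (Set.range z)).map (C : R →+* R[X]) ⊔ Ideal.span {X}).map (Ideal.Quotient.mk (Ideal.span {h}))) := fun j =>
    Ideal.mem_map_of_mem _ (Ideal.mem_sup_left (Ideal.mem_map_of_mem _ (Ideal.subset_span ⟨j, rfl⟩)))
  have hspanv : Ideal.span (Set.range v) = (Ideal.span (Set.range z)).map ((Ideal.Quotient.mk (Ideal.span {h})).comp C) := by
    rw [Ideal.map_span, ← Set.range_comp]
    rfl
  have hJPeq : (((Ideal.span (Set.range z)).map (C : R →+* R[X]) ⊔ Ideal.span {X}).map (Ideal.Quotient.mk (Ideal.span {h}))) = Ideal.span (insert w (Set.range v)) := by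
    rw [Ideal.span_insert, hspanv, Ideal.map_sup, Ideal.map_map, Ideal.map_span _ {X}, Set.image_singleton, sup_comm]
  have hrel : w ^ h.natDegree + ∑ i ∈ Finset.range h.natDegree, Ideal.Quotient.mk (Ideal.span {h}) (C (h.coeff i)) * w ^ i = 0 := by
    have h1 : Ideal.Quotient.mk (Ideal.span {h}) (X ^ h.natDegree + ∑ i ∈ Finset.range h.natDegree, C (h.coeff i) * X ^ i) = 0 := by
      rw [← hmo.as_sum, Ideal.Quotient.eq_zero_iff_mem]
      exact Ideal.subset_span rfl
    rw [map_add, map_pow, map_sum] at h1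
    simp_rw [map_mul, map_pow] at h1
    exact h1
  have hc : ∀ i < h.natDegree, Ideal.Quotient.mk (Ideal.span {h}) (C (h.coeff i)) ∈ Ideal.span (Set.range v) ^ (h.natDegree - i) := by
    intro i hi
    rw [hspanv, ← Ideal.map_pow]
    exact Ideal.mem_map_of_mem _ (hcoJ i hi)
  -- G3b: some `ū_{j₀}/g ∉ 𝔔'`
  obtain ⟨j₀, hj₀⟩ := blowupAlgebra.exists_div_not_mem_of_relation (((Ideal.span (Set.range z)).map (C : R →+* R[X]) ⊔ Ideal.span {X}).map (Ideal.Quotient.mk (Ideal.span {h}))) hwJ hvJ (hJPeq ▸ hg) hc hrel 𝔔'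
  -- G3a: move to the `ū_{j₀}`-chart
  obtain ⟨𝔔'', h𝔔''p, -, hiff, e₁, -⟩ :=
    blowupAlgebra.exists_atPrime_ringEquiv_of_not_mem (((Ideal.span (Set.range z)).map (C : R →+* R[X]) ⊔ Ideal.span {X}).map (Ideal.Quotient.mk (Ideal.span {h}))) hg (hvJ j₀) 𝔔' hj₀
  have h𝔔''c : 𝔔''.comap (algebraMap (R[X] ⧸ Ideal.span {h}) (blowupAlgebra (((Ideal.span (Set.range z)).map (C : R →+* R[X]) ⊔ Ideal.span {X}).map (Ideal.Quotient.mk (Ideal.span {h}))) (v j₀))) =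
      maximalIdeal (R[X] ⧸ Ideal.span {h}) := by
    ext r
    rw [Ideal.mem_comap, hiff, ← Ideal.mem_comap, h𝔔']
  -- the monic transform and the chart isomorphism (p526498)
  have hrsop : IsRsopPart z := ⟨inferInstance, l, y, hdim, by rw [← range_fin_append, hzy]⟩
  have key := exists_monic_transform_ringEquiv z (J := Finset.univ) (j₀ := j₀) hmo
    (fun i hi => by
      rw [Finset.coe_univ, Set.image_univ]
      have hi' := Finset.mem_Icc.mp hi
      have := hcoJ (h.natDegree - i) (by omega)
      rwa [show h.natDegree - (h.natDegree - i) = i by omega] at this)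
    (by rw [Finset.coe_univ, Set.image_univ]; exact prime_algebraMap_blowupAlgebra_of_isRsopPart hrsop j₀)
  rw [Finset.coe_univ, Set.image_univ] at key
  obtain ⟨h', hmon', hdeg', hcoef', e, he⟩ := key
  -- the prime on `S[X]/(h')` and the transported localisation
  set 𝔔₃ : Ideal (AdjoinRoot h') :=
    𝔔''.comap (e : AdjoinRoot h' →+* blowupAlgebra (((Ideal.span (Set.range z)).map (C : R →+* R[X]) ⊔ Ideal.span {X}).map (Ideal.Quotient.mk (Ideal.span {h}))) (v j₀)) with h𝔔₃
  haveI h𝔔₃p : 𝔔₃.IsPrime := Ideal.comap_isPrime _ _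
  have hM : 𝔔₃.primeCompl.map e.toMonoidHom = 𝔔''.primeCompl := by
    ext y
    simp only [Submonoid.mem_map, Ideal.mem_primeCompl_iff]
    constructor
    · rintro ⟨x, hx, rfl⟩
      exact fun hy => hx (Ideal.mem_comap.mpr hy)
    · intro hy
      refine ⟨e.symm y, fun hx => hy ?_, e.apply_symm_apply y⟩
      have := Ideal.mem_comap.mp hx
      rwa [RingHom.coe_coe, e.apply_symm_apply] at this
  let e₃ : Localization.AtPrime 𝔔₃ ≃+* Localization.AtPrime 𝔔'' :=
    IsLocalization.ringEquivOfRingEquiv (M := 𝔔₃.primeCompl) (T := 𝔔''.primeCompl) (Localization.AtPrime 𝔔₃)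
      (Localization.AtPrime 𝔔'') e hM
  -- the presentation on the transformed frame
  obtain ⟨hf₁, hl₁, hm₁, hr₁⟩ := presentation_comp_ringEquiv (T := Localization.AtPrime 𝔔') (T' := Localization.AtPrime 𝔔'')
    ψ' hflat hloc hmap hres e₁
  obtain ⟨hf₂, hl₂, hm₂, hr₂⟩ := presentation_comp_ringEquiv (T := Localization.AtPrime 𝔔'') (T' := Localization.AtPrime 𝔔₃)
    _ hf₁ hl₁ hm₁ hr₁ e₃.symm
  refine ⟨j₀, h', 𝔔₃, h𝔔₃p, _, hmon', hdeg', hcoef', ?_, hf₂, hl₂, hm₂, hr₂⟩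
  -- `𝔔₃` lies over `𝔪_R`
  ext r
  have h1 := he (C r)
  rw [eval₂_C, RingHom.comp_apply] at h1
  have h2 := (SetLike.ext_iff.mp h𝔔''c (Ideal.Quotient.mk (Ideal.span {h}) (C r))).symm
  rw [Ideal.mem_comap, Ideal.mem_comap, Ideal.mem_comap, h𝔔₃, Ideal.mem_comap, RingHom.coe_coe, ← hcomapR, Ideal.mem_comap,
    Ideal.mem_comap, h2, Ideal.mem_comap, h1]

end Summit.ResolutionOfSingularities.ResolutionOfSingularities.Theorems.SigmaMaxModificationsCorridor3.Helpers

end
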